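import Literature.NumberTheory.Automorphic.MeanSquareRegionVolumeGL2
import Literature.NumberTheory.Automorphic.CuspidalWhittakerGL2
import Literature.NumberTheory.Automorphic.InvariantMeasureDominationExplicit
import HarnessLib

/-!
# The mean-square upper bound on `GL₂`

Topic `NumberTheory/Automorphic`; namespace `Literature.NumberTheory.Automorphic`. A brick of the
mean-square route to Jacquet–Shalika's Theorem (5.3) for `GL₂`
(`StandardLFunctionData.multipliable_L`). For a continuous function `F` on the automorphic
quotient `GL₂(𝔸_K) ⧸ A_G GL₂(K)`, `φ = invQuot F` and its global Whittaker coefficient `W_φ`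
(Tate's character `adeleAddChar K`, Tate's box `𝓕_N = unipotentTateDomain 2 K`, a Haar measure `ν`
on `N₂(𝔸_K)`), the mean-square method integrates Bessel's inequality
`∑_ξ |W_φ(d(ξ) g)|² ≤ ν(𝓕_N)⁻¹ ∫_{𝓕_N} |φ(u g)|² dν` (`WhittakerBesselGL2`) over
`g = d(a₁, a₂) k`, `a₁ ∈ z(r) Y₁`, `a₂ ∈ C₂`, `k ∈ K_c`, and bounds the result **uniformly in the
dilation parameter `r ≤ 1`**:

* `tsum_enorm_sq_whittakerCoeff_le_lintegral` — Bessel's inequality in `ℝ≥0∞` form;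
* `exists_meanSquare_upper_bound` — **there is `C < ∞` with
  `∫_{z(r)Y₁} ∫_{C₂} ∫_{K_c} ∑'_ξ ‖W_φ(d(ξ) d(a₁,a₂) k)‖ₑ² ≤ C ‖F‖₂²` for all continuous `F` and all
  `r ≤ 1`**. The chain: Bessel; the Jacobian inequality `lintegral_regionCoords_le`
  (`MeanSquareRegionVolumeGL2`) bounding the coordinate integral of `|φ|²` by
  `C_J Δ(z(r)) ∫_{D_r} |φ|² dμ_G` over the compact region `D_r = closure 𝓕_N · d(z(r)Y₁, C₂) · K`
  (`iwasawaRegionGL2`); the domination lemma with explicit constant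
  `lintegral_smul_inv_smul_le_mul` (`InvariantMeasureDominationExplicit`):
  `∫_{D_r} |φ|² ≤ μ_G(closure(B' D_r)) / μ(U) · ‖F‖₂²`; the thickening
  `closure (B' D_r) ⊆ D'_r` (`exists_thickening_iwasawaRegionGL2_subset`, `DilationThickeningGL2`) and
  the volume bound `μ_G(D'_r) ≤ C_V Δ(z(r))⁻¹` (`measure_iwasawaRegionGL2_le`); the factors
  `Δ(z(r)) Δ(z(r))⁻¹` cancel.

`glTwoBorel K` is the Borel σ-algebra of `GL₂(𝔸_K)` in the `GL` spelling (the tree's local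
instance `adelicBorel 2 K` lives on `(gl 2 K).Adelic`); both are local instances here, so that the
Haar measure `adelicHaar 2 K` of `SmoothedAutomorphicForms` serves on both sides. Everything is
proved; folklore (the mean-square/Rankin–Selberg method at real points: Rankin (1939), Jacquet–
Shalika (1981), §5 for the Eisenstein-series form).
-/

noncomputable section

open MeasureTheory Measure NumberField IsDedekindDomain Matrix Set Filter Topology
open scoped MatrixGroups ENNReal NNReal Pointwise ComplexConjugate

namespace Literature.NumberTheory.Automorphic

section Upper

variable (K : Type) [Field K] [NumberField K]

attribute [local instance] adelicBorel borelSpace_adelic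

/-- The Borel σ-algebra of `GL₂(𝔸_K)` in the `GL` spelling (the same as `adelicBorel 2 K` on
`(gl 2 K).Adelic`; local instance). [folklore] -/
@[reducible] def glTwoBorel : MeasurableSpace (GL (Fin 2) (AdeleRing (𝓞 K) K)) := adelicBorel 2 K

attribute [local instance] glTwoBorel

/-- `GL₂(𝔸_K)` with `glTwoBorel` is a Borel space. [folklore] -/
theorem borelSpace_glTwo : BorelSpace (GL (Fin 2) (AdeleRing (𝓞 K) K)) := ⟨rfl⟩

attribute [local instance] borelSpace_glTwo

variable {K}
variable {μ : Measure (AdelicGroupData.gl 2 K).automorphicQuotient} [(AdelicGroupData.gl 2 K).IsAutomorphicMeasure μ]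
  [MeasurableSpace (AdeleRing (𝓞 K) K)] [BorelSpace (AdeleRing (𝓞 K) K)]
  [MeasurableSpace (adeleQuotient K)] [BorelSpace (adeleQuotient K)]

/-- **Bessel's inequality in `ℝ≥0∞` form**: for continuous `F` on the automorphic quotient of `GL₂`,
`φ = invQuot F` and a Haar measure `ν` on `N₂(𝔸_K)`,
`∑'_ξ ‖W_φ(d(ξ) g)‖ₑ² ≤ ν(𝓕_N)⁻¹ ∫⁻_{𝓕_N} ‖φ(u g)‖ₑ² dν`. [folklore] -/
theorem tsum_enorm_sq_whittakerCoeff_le_lintegral {F : (AdelicGroupData.gl 2 K).automorphicQuotient → ℂ}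
    (hF : Continuous F) (ν : Measure ↥(adelicUnipotent 2 K)) [IsHaarMeasure ν]
    (g : GL (Fin 2) (AdeleRing (𝓞 K) K)) :
    ∑' ξ : Kˣ, ‖whittakerCoeff ν (unipotentTateDomain 2 K) (adeleAddChar K)
        (invQuot (AdelicGroupData.gl 2 K) F) (ratDiagGL2 K ξ * g)‖ₑ ^ 2 ≤
      (ν (unipotentTateDomain 2 K))⁻¹ *
        ∫⁻ u in unipotentTateDomain 2 K, ‖invQuot (AdelicGroupData.gl 2 K) F ((u : GL (Fin 2) (AdeleRing (𝓞 K) K)) * g)‖ₑ ^ 2 ∂ν := by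
  set φ := invQuot (AdelicGroupData.gl 2 K) F with hφ
  have hφc : Continuous φ := hF.comp ((AdelicGroupData.gl 2 K).continuous_toAutomorphicQuotient.comp
    (continuous_inv : Continuous fun g : (AdelicGroupData.gl 2 K).Adelic => g⁻¹))
  have h := tsum_enorm_sq_whittakerCoeff_ratDiagGL2_le (isLeftInvariant_invQuot _ _) hφc ν g
  refine h.trans ?_
  have h0 : ν (unipotentTateDomain 2 K) ≠ 0 := (measure_unipotentTateDomain_pos_of_isHaarMeasure ν).ne'
  have htop : ν (unipotentTateDomain 2 K) ≠ ⊤ := (measure_unipotentTateDomain_lt_top ν).ne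
  -- integrability of the continuous integrand on the relatively compact `𝓕_N`
  have hgc : Continuous fun u : ↥(adelicUnipotent 2 K) => ‖φ ((u : GL (Fin 2) (AdeleRing (𝓞 K) K)) * g)‖ ^ 2 :=
    (hφc.comp ((continuous_subtype_val).mul continuous_const)).norm.pow 2
  obtain ⟨M, hM⟩ := (isCompact_closure_unipotentTateDomain (n := 2) (K := K)).exists_bound_of_continuousOn hgc.continuousOn
  have hint : IntegrableOn (fun u : ↥(adelicUnipotent 2 K) => ‖φ ((u : GL (Fin 2) (AdeleRing (𝓞 K) K)) * g)‖ ^ 2)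
      (unipotentTateDomain 2 K) ν := by
    refine Measure.integrableOn_of_bounded (M := M) htop hgc.aestronglyMeasurable ?_
    refine (ae_restrict_iff' measurableSet_unipotentTateDomain).2 (Eventually.of_forall fun u hu => ?_)
    exact hM u (subset_closure hu)
  rw [ENNReal.ofReal_mul (by positivity), ← ENNReal.toReal_inv, ENNReal.ofReal_toReal (ENNReal.inv_ne_top.2 h0),
    ofReal_integral_eq_lintegral_ofReal hint (Eventually.of_forall fun u => by positivity)]
  gcongr
  rw [← ofReal_norm, ← ENNReal.ofReal_pow (norm_nonneg _)]

/-- **The mean-square upper bound.** Let `F` be continuous on the automorphic quotient of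
`GL₂(𝔸_K)`, `φ = invQuot F`, `W_φ` its Whittaker coefficient (Tate's character, Tate's box `𝓕_N`,
a Haar measure `ν` on `N₂(𝔸_K)`), `Y₁, C₂ ⊆ 𝔸_Kˣ` compact and `K_c ⊆ K`. There is `C < ∞`, not
depending on `F`, such that for every `r ≤ 1`,
`∫_{z(r)Y₁} ∫_{C₂} ∫_{K_c} ∑'_{ξ ∈ Kˣ} ‖W_φ(d(ξ a₁, a₂) k)‖² dμ_K dμ_I dμ_I ≤ C ‖F‖₂²`.
Proof: Bessel (`WhittakerBesselGL2`) bounds the sum by `ν(𝓕_N)⁻¹ ∫_{𝓕_N} |φ(u d(a) k)|²`; the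
Jacobian inequality (`lintegral_regionCoords_le`) bounds the coordinate integral by
`C_J Δ(z(r)) ∫_{D_r} |φ|² dμ_G` over the region `D_r = closure 𝓕_N · d(z(r)Y₁, C₂) · K`; the
domination lemma with its explicit constant (`lintegral_smul_inv_smul_le_mul`) bounds this by
`μ_G(closure (B' D_r)) / μ(U) · ‖F‖₂²`; and the thickening and volume bounds
(`exists_thickening_iwasawaRegionGL2_subset`, `measure_iwasawaRegionGL2_le`) give
`μ_G(closure (B' D_r)) ≤ C_V Δ(z(r))⁻¹`. [folklore] -/
theorem exists_meanSquare_upper_bound [MeasurableSpace (AdeleRing (𝓞 K) K)ˣ] [BorelSpace (AdeleRing (𝓞 K) K)ˣ]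
    (ν : Measure ↥(adelicUnipotent 2 K)) [IsHaarMeasure ν]
    (μI : Measure (AdeleRing (𝓞 K) K)ˣ) [IsHaarMeasure μI]
    (μK : Measure ↥(standardMaximalCompactGL 2 K)) [IsHaarMeasure μK]
    {Y₁ C₂ : Set (AdeleRing (𝓞 K) K)ˣ} (hY₁ : IsCompact Y₁) (hC₂ : IsCompact C₂)
    (Kc : Set ↥(standardMaximalCompactGL 2 K)) :
    ∃ C : ℝ≥0∞, C ≠ ⊤ ∧ ∀ {F : (AdelicGroupData.gl 2 K).automorphicQuotient → ℂ}, Continuous F →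
      ∀ r : ℝ≥0ˣ, (r : ℝ≥0) ≤ 1 →
        ∫⁻ a₁ in posRealIdele K r • Y₁, ∫⁻ a₂ in C₂, ∫⁻ k in Kc,
            ∑' ξ : Kˣ, ‖whittakerCoeff ν (unipotentTateDomain 2 K) (adeleAddChar K)
              (invQuot (AdelicGroupData.gl 2 K) F)
              (ratDiagGL2 K ξ * (diagGL2 a₁ a₂ * (k : GL (Fin 2) (AdeleRing (𝓞 K) K))))‖ₑ ^ 2 ∂μK ∂μI ∂μI ≤
          C * ∫⁻ x, ‖F x‖ₑ ^ 2 ∂μ := by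
  haveI : T2Space (AdeleRing (𝓞 K) K) := t2Space_adeleRing K
  haveI := locallyCompactSpace_adeleRing' K
  haveI := locallyCompactSpace_ideleGroup K
  haveI := secondCountableTopology_ideleGroup K
  haveI := t2Space_ideleGroup K
  obtain ⟨hT2G, hLCG, hSCG⟩ := topology_gl2_adele K
  haveI : LocallyCompactSpace (AdelicGroupData.gl 2 K).Adelic := hLCG
  haveI : SecondCountableTopology (AdelicGroupData.gl 2 K).Adelic := hSCG
  haveI : CompactSpace ↥(standardMaximalCompactGL 2 K) :=
    isCompact_iff_compactSpace.1 (isCompact_standardMaximalCompactGL 2 K)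
  haveI : IsFiniteMeasure μK := CompactSpace.isFiniteMeasure
  haveI : MeasurableSMul₂ (AdelicGroupData.gl 2 K).Adelic (AdelicGroupData.gl 2 K).automorphicQuotient :=
    measurableSMul₂_gl_automorphicQuotient 2 K
  set μG : Measure (GL (Fin 2) (AdeleRing (𝓞 K) K)) := adelicHaar 2 K with hμG
  haveI : IsHaarMeasure μG := inferInstanceAs ((adelicHaar 2 K).IsHaarMeasure)
  set 𝓕 := unipotentTateDomain 2 K with h𝓕def
  have h𝓕0 : ν 𝓕 ≠ 0 := (measure_unipotentTateDomain_pos_of_isHaarMeasure ν).ne'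
  have h𝓕top : ν 𝓕 ≠ ⊤ := (measure_unipotentTateDomain_lt_top ν).ne
  have h𝓕c : IsCompact (closure 𝓕) := isCompact_closure_unipotentTateDomain
  -- thickening, volume and Jacobian constants
  obtain ⟨B', hB'1, N'', hN''c, Y₁', C₂', hY₁', hC₂', hthick⟩ :=
    exists_thickening_iwasawaRegionGL2_subset (K := K) h𝓕c hY₁ hC₂
  obtain ⟨CV, hCVtop, hCV⟩ := measure_iwasawaRegionGL2_le (K := K) μG μI ν μK hN''c hY₁' hC₂'
  obtain ⟨CJ, hCJtop, hCJ⟩ := lintegral_regionCoords_le (K := K) μG μI ν μK hY₁ hC₂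
  -- the orbit neighbourhood of the base point
  set U : Set (AdelicGroupData.gl 2 K).automorphicQuotient :=
    (fun g : (AdelicGroupData.gl 2 K).Adelic => g • basePoint 2 K) '' interior B' with hU
  have hUpos : 0 < μ U := measure_orbitNhd_pos μ (isOpenMap_smul_basePoint 2 K) hB'1
  refine ⟨(ν 𝓕)⁻¹ * (CJ * (CV / μ U)), ?_, fun {F} hF r hr => ?_⟩
  · exact ENNReal.mul_ne_top (ENNReal.inv_ne_top.2 h𝓕0)
      (ENNReal.mul_ne_top hCJtop (ENNReal.div_ne_top hCVtop hUpos.ne'))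
  set φ := invQuot (AdelicGroupData.gl 2 K) F with hφ
  have hφc : Continuous φ := hF.comp ((AdelicGroupData.gl 2 K).continuous_toAutomorphicQuotient.comp
    (continuous_inv : Continuous fun g : (AdelicGroupData.gl 2 K).Adelic => g⁻¹))
  set Φ : GL (Fin 2) (AdeleRing (𝓞 K) K) → ℝ≥0∞ := fun g => ‖φ g‖ₑ ^ 2 with hΦ
  have hΦm : Measurable Φ := (hφc.measurable.enorm.pow_const 2)
  set ρ := posRealIdele K r with hρ
  set Δρ : ℝ≥0∞ := ((distribHaarChar (AdeleRing (𝓞 K) K) ρ : ℝ≥0) : ℝ≥0∞) with hΔρ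
  have hΔ0 : Δρ ≠ 0 := by rw [hΔρ, Ne, ENNReal.coe_eq_zero]; exact (distribHaarChar_pos).ne'
  have hΔtop : Δρ ≠ ⊤ := ENNReal.coe_ne_top
  set D : Set (GL (Fin 2) (AdeleRing (𝓞 K) K)) := iwasawaRegionGL2 K (closure 𝓕) (ρ • Y₁) C₂ with hD
  have hDc : IsCompact D := isCompact_iwasawaRegionGL2 h𝓕c (hY₁.smul ρ) hC₂
  have hDm : MeasurableSet D := hDc.isClosed.measurableSet
  -- Step 1: Bessel, pull out the constant, swap `k` and `u`
  have h1 : ∀ a₁ a₂ : (AdeleRing (𝓞 K) K)ˣ,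
      ∫⁻ k in Kc, ∑' ξ : Kˣ, ‖whittakerCoeff ν 𝓕 (adeleAddChar K) φ
        (ratDiagGL2 K ξ * (diagGL2 a₁ a₂ * (k : GL (Fin 2) (AdeleRing (𝓞 K) K))))‖ₑ ^ 2 ∂μK ≤
        (ν 𝓕)⁻¹ * ∫⁻ u in 𝓕, ∫⁻ k in Kc, Φ ((u : GL (Fin 2) (AdeleRing (𝓞 K) K)) * diagGL2 a₁ a₂ *
          (k : GL (Fin 2) (AdeleRing (𝓞 K) K))) ∂μK ∂ν := by
    intro a₁ a₂
    calc ∫⁻ k in Kc, ∑' ξ : Kˣ, ‖whittakerCoeff ν 𝓕 (adeleAddChar K) φ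
          (ratDiagGL2 K ξ * (diagGL2 a₁ a₂ * (k : GL (Fin 2) (AdeleRing (𝓞 K) K))))‖ₑ ^ 2 ∂μK
        ≤ ∫⁻ k in Kc, (ν 𝓕)⁻¹ * ∫⁻ u in 𝓕, Φ ((u : GL (Fin 2) (AdeleRing (𝓞 K) K)) *
            (diagGL2 a₁ a₂ * (k : GL (Fin 2) (AdeleRing (𝓞 K) K)))) ∂ν ∂μK :=
          lintegral_mono fun k => tsum_enorm_sq_whittakerCoeff_le_lintegral hF ν _
      _ = (ν 𝓕)⁻¹ * ∫⁻ k in Kc, ∫⁻ u in 𝓕, Φ ((u : GL (Fin 2) (AdeleRing (𝓞 K) K)) * diagGL2 a₁ a₂ *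
            (k : GL (Fin 2) (AdeleRing (𝓞 K) K))) ∂ν ∂μK := by
          rw [lintegral_const_mul' _ _ (ENNReal.inv_ne_top.2 h𝓕0)]
          simp only [mul_assoc]
      _ = (ν 𝓕)⁻¹ * ∫⁻ u in 𝓕, ∫⁻ k in Kc, Φ ((u : GL (Fin 2) (AdeleRing (𝓞 K) K)) * diagGL2 a₁ a₂ *
            (k : GL (Fin 2) (AdeleRing (𝓞 K) K))) ∂μK ∂ν := by
          rw [lintegral_lintegral_swap]
          exact (hΦm.comp (((continuous_subtype_val.comp continuous_snd).mul continuous_const).mul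
            (continuous_subtype_val.comp continuous_fst)).measurable).aemeasurable
  -- Step 2: the Jacobian inequality, with `f = 1_D Φ`
  have h2 : ∫⁻ a₁ in ρ • Y₁, ∫⁻ a₂ in C₂, ∫⁻ u in 𝓕, ∫⁻ k in Kc,
      Φ ((u : GL (Fin 2) (AdeleRing (𝓞 K) K)) * diagGL2 a₁ a₂ * (k : GL (Fin 2) (AdeleRing (𝓞 K) K))) ∂μK ∂ν ∂μI ∂μI ≤
      CJ * Δρ * ∫⁻ g in D, Φ g ∂μG := by
    have hmY : MeasurableSet (ρ • Y₁) := (hY₁.smul ρ).isClosed.measurableSet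
    have hmC : MeasurableSet C₂ := hC₂.isClosed.measurableSet
    have heq : ∫⁻ a₁ in ρ • Y₁, ∫⁻ a₂ in C₂, ∫⁻ u in 𝓕, ∫⁻ k in Kc,
        Φ ((u : GL (Fin 2) (AdeleRing (𝓞 K) K)) * diagGL2 a₁ a₂ * (k : GL (Fin 2) (AdeleRing (𝓞 K) K))) ∂μK ∂ν ∂μI ∂μI =
        ∫⁻ a₁ in ρ • Y₁, ∫⁻ a₂ in C₂, ∫⁻ u in 𝓕, ∫⁻ k in Kc,
          D.indicator Φ ((u : GL (Fin 2) (AdeleRing (𝓞 K) K)) * diagGL2 a₁ a₂ * (k : GL (Fin 2) (AdeleRing (𝓞 K) K))) ∂μK ∂ν ∂μI ∂μI := by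
      refine setLIntegral_congr_fun hmY fun a₁ ha₁ => setLIntegral_congr_fun hmC fun a₂ ha₂ =>
        setLIntegral_congr_fun measurableSet_unipotentTateDomain fun u hu => lintegral_congr fun k => ?_
      rw [indicator_of_mem]
      exact mul_mul_mem_iwasawaRegionGL2 (subset_closure hu) ha₁ ha₂ k.2
    rw [heq]
    refine (hCJ r 𝓕 Kc (hΦm.indicator hDm)).trans (le_of_eq ?_)
    rw [lintegral_indicator hDm]
  -- Step 3: domination with the explicit constant
  have h3 : ∫⁻ g in D, Φ g ∂μG ≤ μG (closure (B' * D)) / μ U * ∫⁻ x, ‖F x‖ₑ ^ 2 ∂μ := by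
    have h := lintegral_smul_inv_smul_le_mul μ (adelicHaar 2 K) (x₀ := basePoint 2 K) (isOpenMap_smul_basePoint 2 K)
      hB'1 D (F := fun x => ‖F x‖ₑ ^ 2) (hF.measurable.enorm.pow_const 2) 1
    have heq : ∀ g : (AdelicGroupData.gl 2 K).Adelic, Φ g = ‖F ((1 : (AdelicGroupData.gl 2 K).Adelic) • g⁻¹ • basePoint 2 K)‖ₑ ^ 2 := by
      intro g
      rw [one_smul, smul_basePoint, hΦ]
      simp only [hφ, invQuot_apply]
    simp_rw [← heq] at h
    exact h
  -- Step 4: thickening and volume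
  have h4 : μG (closure (B' * D)) ≤ CV * Δρ⁻¹ := by
    have hsub : closure (B' * D) ⊆ iwasawaRegionGL2 K N'' (ρ • Y₁') C₂' :=
      closure_minimal (hthick r hr) (isCompact_iwasawaRegionGL2 hN''c (hY₁'.smul ρ) hC₂').isClosed
    exact (measure_mono hsub).trans (hCV r hr)
  -- assemble
  calc ∫⁻ a₁ in ρ • Y₁, ∫⁻ a₂ in C₂, ∫⁻ k in Kc, ∑' ξ : Kˣ, ‖whittakerCoeff ν 𝓕 (adeleAddChar K) φ
          (ratDiagGL2 K ξ * (diagGL2 a₁ a₂ * (k : GL (Fin 2) (AdeleRing (𝓞 K) K))))‖ₑ ^ 2 ∂μK ∂μI ∂μI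
      ≤ ∫⁻ a₁ in ρ • Y₁, ∫⁻ a₂ in C₂, (ν 𝓕)⁻¹ * ∫⁻ u in 𝓕, ∫⁻ k in Kc,
          Φ ((u : GL (Fin 2) (AdeleRing (𝓞 K) K)) * diagGL2 a₁ a₂ * (k : GL (Fin 2) (AdeleRing (𝓞 K) K))) ∂μK ∂ν ∂μI ∂μI :=
        lintegral_mono fun a₁ => lintegral_mono fun a₂ => h1 a₁ a₂
    _ = (ν 𝓕)⁻¹ * ∫⁻ a₁ in ρ • Y₁, ∫⁻ a₂ in C₂, ∫⁻ u in 𝓕, ∫⁻ k in Kc,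
          Φ ((u : GL (Fin 2) (AdeleRing (𝓞 K) K)) * diagGL2 a₁ a₂ * (k : GL (Fin 2) (AdeleRing (𝓞 K) K))) ∂μK ∂ν ∂μI ∂μI := by
        rw [← lintegral_const_mul' _ _ (ENNReal.inv_ne_top.2 h𝓕0)]
        congr 1; funext a₁
        rw [lintegral_const_mul' _ _ (ENNReal.inv_ne_top.2 h𝓕0)]
    _ ≤ (ν 𝓕)⁻¹ * (CJ * Δρ * ∫⁻ g in D, Φ g ∂μG) := by gcongr
    _ ≤ (ν 𝓕)⁻¹ * (CJ * Δρ * (μG (closure (B' * D)) / μ U * ∫⁻ x, ‖F x‖ₑ ^ 2 ∂μ)) := by gcongr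
    _ ≤ (ν 𝓕)⁻¹ * (CJ * Δρ * (CV * Δρ⁻¹ / μ U * ∫⁻ x, ‖F x‖ₑ ^ 2 ∂μ)) := by gcongr
    _ = (ν 𝓕)⁻¹ * (CJ * (CV / μ U)) * ∫⁻ x, ‖F x‖ₑ ^ 2 ∂μ := by
        rw [show CV * Δρ⁻¹ / μ U = Δρ⁻¹ * (CV / μ U) by rw [mul_comm, mul_div_assoc]]
        rw [show CJ * Δρ * (Δρ⁻¹ * (CV / μ U) * ∫⁻ x, ‖F x‖ₑ ^ 2 ∂μ) =
          CJ * (Δρ * Δρ⁻¹) * (CV / μ U) * ∫⁻ x, ‖F x‖ₑ ^ 2 ∂μ by ring]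
        rw [ENNReal.mul_inv_cancel hΔ0 hΔtop, mul_one]
        ring

end Upper

end Literature.NumberTheory.Automorphic
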